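import Summits.ResolutionOfSingularities.ResolutionOfSingularities.Theorems.WildQuotientsWildQuotientResolutionS1PlanarFieldDefs
import HarnessLib.Audit.Tags

/-!
# S1 · `W1NPrint p` from the bad-node CASCADE (support skeleton for `stub_W1N_print`)

Crux stmt-ResolutionOfSingularities-17941 (`WildQuotients.CyclicQuotientFourfolds`), S1a skeleton line
`s1a-logminvertex` (plan-1 `S1A-CUT.md`; RULING D2 v1 18:13:15Z item (5): `stub_W1N_print : ∀ p, p.Prime →
S1.W1NPrint p`, «AI-level proof W1N-CASCADE (three books)»).  [OURS · L1 W4.5c] — NOT statements of the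
manuscript; AI-level, weaker than expert review; counted 0 post-V5.

This file turns the three-book hand proof of the residual `(W1-N)_p` (tri-2 `W1N-CASCADE.md` §1–§3, idea-1
`DELTA.md` §9, tri-1 engine census) into a Lean PLAN over D1's names: FIVE named support statements about ONE
or TWO or THREE blow-up steps of a planar formal vector field — each a genuine lemma of commutative algebra in
`κ[[x,y]]`, characteristic-free — and the KERNEL-CHECKED COMPOSITION

  `W1NPrint_of_cascade : MilnorFloor → IsolatedSucc → OStep → NStep → NTwoExit → ∀ p, S1.W1NPrint p`

(sorry-free; strong induction on the Milnor number with a two-step look-ahead, `N := 2 μ − 1`).  So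
`stub_W1N_print p _ := W1NPrint_of_cascade hF hI hO hN hX p` once the five supports are proved; the five are
claimable independently (`--supports stmt-ResolutionOfSingularities-17941`).

The five statements (θ an ISOLATED BAD node, `μ = milnor`, `L = linearPart`; successors = D1's `IsSucc`,
i.e. saturated point-blow-up transforms at the `κ`-rational points of the exceptional line):
* `MilnorFloor`  — `μ(θ) ≥ 2` (μ = 1 forces `(a,b) = 𝔪`, i.e. `L` invertible, not nilpotent).
* `IsolatedSucc` — isolatedness propagates to every successor (a common factor of the transform pair
  would come from a common factor of `(a, b − (y + c) a)∘π` off the exceptional line).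
* `OStep`        — `L(θ) = 0` (order `ν ≥ 2`): every successor has `μ' < μ`.  Hand proof: Max Noether's
  inequality AT ONE POINT (in tree: `…Theorems.WildCones.MuDropCharTwoOrdP.noether_inequality`) gives per child
  `μ' ≤ μ − ν² + ν + 1 ≤ μ − 1` (non-dicritical) and `μ' ≤ μ − ν² − 1` (dicritical) — DELTA §9.2 = W1N §1.
* `NStep`        — `L(θ) ≠ 0` nilpotent (type N) and `μ ≥ 3`: every BAD grand-successor has `μ'' < μ`.  Hand
  proof: N-normal form `θ = y ∂ₓ + (β x^μ u + y c(x) + y² e) ∂_y` (formal inverse function theorem), the unique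
  singular successor `Q` has `μ(Q) = μ + 1`, `L(Q) = 0`, and every bad successor of `Q` has Milnor number
  `≤ μ − 1` (`p` odd; `p = 2` non-dicritical: `≤ μ − 2`, the corner child being D-type = not bad; `p = 2`
  dicritical: `≤ μ − 4`) — DELTA §9.4 (i)–(iv) = W1N §2 (i)–(iv).  The hypothesis «grand-successor BAD» is
  load-bearing: for `p = 2`, `μ = 3` the corner grandchild is D-type with Milnor number `3 = μ`.
* `NTwoExit`     — type N with `μ = 2`: the third successor is never bad (`N(2) → N(3) → O(4) →` reduced or
  regular) — DELTA §9.4 (v) = W1N §2 (v).  Load-bearing: the inequalities alone allow `N(2) → N(3) → O(4) → N(2)`.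
Composition (DELTA §9.5): along a chain of bad nodes the Milnor number drops within one step (`OStep`) or two
steps (`NStep`) or the chain leaves the bad class within three steps (`NTwoExit`); hence at most `2 μ − 1`
consecutive bad nodes.  No `MvPowerSeries` mathematics happens in this file — only the induction.
-/

noncomputable section

-- single-problem summit: the doubled namespace component `ResolutionOfSingularities` is forced
set_option linter.dupNamespace false

namespace Summit.ResolutionOfSingularities.ResolutionOfSingularities.Theorems.WildQuotientResolution.S1

namespace W1NCascade

/-- **Support (floor).** An isolated BAD node has Milnor number at least `2`: `μ = 0` is excluded by
singularity, `μ = 1` means `(a, b) = 𝔪`, i.e. the linear part is invertible, hence not nilpotent.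
[OURS · L1 W4.5c] — NOT a statement of the manuscript. -/
@[conjecture]
def MilnorFloor : Prop :=
  ∀ (κ : Type) [Field κ] (θ : PlanarField κ), θ.IsIsolated → θ.IsBadNode → 2 ≤ θ.milnor

/-- **Support (isolatedness propagates).** Every successor (saturated point-blow-up transform at a rational
point of the exceptional line) of an isolated planar field is isolated.
[OURS · L1 W4.5c] — NOT a statement of the manuscript. -/
@[conjecture]
def IsolatedSucc : Prop :=
  ∀ (κ : Type) [Field κ] (θ θ' : PlanarField κ), θ.IsIsolated → θ.IsSucc θ' → θ'.IsIsolated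

/-- **Support (O-step).** A bad node with ZERO linear part (order `ν ≥ 2`) strictly loses Milnor number at
every successor: Max Noether's inequality at one point of the blow-up gives `μ' ≤ μ − ν² + ν + 1 ≤ μ − 1`
(non-dicritical) and `μ' ≤ μ − ν² − 1` (dicritical).  Source: DELTA.md §9.2 / W1N-CASCADE.md §1; engine
`…Theorems.WildCones.MuDropCharTwoOrdP.noether_inequality` (in tree).
[OURS · L1 W4.5c] — NOT a statement of the manuscript. -/
@[conjecture]
def OStep : Prop :=
  ∀ (κ : Type) [Field κ] (θ θ' : PlanarField κ), θ.IsIsolated → θ.IsBadNode → θ.linearPart = 0 →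
    θ.IsSucc θ' → θ'.IsIsolated → θ'.milnor < θ.milnor

/-- **Support (N-step).** A bad node of type N (non-zero nilpotent linear part) with `μ ≥ 3`: every BAD
grand-successor has strictly smaller Milnor number.  (Via the N-normal form: the unique singular successor
`Q` has `μ(Q) = μ + 1` and zero linear part; its bad successors have Milnor number `≤ μ − 1`, resp. `≤ μ − 2` /
`≤ μ − 4` in the two characteristic-`2` sub-cases; the D-type corner grandchild for `p = 2` is not bad, which is
why badness of the grand-successor is a hypothesis.)  Source: DELTA.md §9.3–§9.4 (i)–(iv) / W1N-CASCADE.md §2.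
[OURS · L1 W4.5c] — NOT a statement of the manuscript. -/
@[conjecture]
def NStep : Prop :=
  ∀ (κ : Type) [Field κ] (θ θ₁ θ₂ : PlanarField κ), θ.IsIsolated → θ.IsBadNode → θ.linearPart ≠ 0 →
    3 ≤ θ.milnor → θ.IsSucc θ₁ → θ₁.IsSucc θ₂ → θ₁.IsIsolated → θ₁.IsBadNode → θ₂.IsIsolated →
    θ₂.IsBadNode → θ₂.milnor < θ.milnor

/-- **Support (N(2)-exit).** A bad node of type N with `μ = 2`: no chain of three successors stays in the
bad class (`N(2) → N(3) → O(4) →` every successor of `O(4)` is regular, non-degenerate or D-type).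
Source: DELTA.md §9.4 (v) / W1N-CASCADE.md §2 (v).
[OURS · L1 W4.5c] — NOT a statement of the manuscript. -/
@[conjecture]
def NTwoExit : Prop :=
  ∀ (κ : Type) [Field κ] (θ θ₁ θ₂ θ₃ : PlanarField κ), θ.IsIsolated → θ.IsBadNode → θ.linearPart ≠ 0 →
    θ.milnor = 2 → θ.IsSucc θ₁ → θ₁.IsSucc θ₂ → θ₂.IsSucc θ₃ → θ₁.IsIsolated → θ₁.IsBadNode →
    θ₂.IsIsolated → θ₂.IsBadNode → θ₃.IsIsolated → ¬ θ₃.IsBadNode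

/-- The induction behind `W1NPrint_of_cascade`: from an isolated bad node of Milnor number `≤ n`, every
successor chain with at least `2 n` nodes contains a node that is not bad.
[OURS · L1 W4.5c] — NOT a statement of the manuscript. -/
theorem exists_not_bad_of_milnor_le (hF : MilnorFloor) (hI : IsolatedSucc) (hO : OStep) (hN : NStep)
    (hX : NTwoExit) {κ : Type} [Field κ] (n : ℕ) :
    ∀ (θ : PlanarField κ), θ.IsIsolated → θ.IsBadNode → θ.milnor ≤ n →
      ∀ (N : ℕ), 2 * n ≤ N + 1 → ∀ chain : Fin (N + 1) → PlanarField κ, chain 0 = θ →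
        (∀ i : Fin N, (chain i.castSucc).IsSucc (chain i.succ)) → ∃ i, ¬ (chain i).IsBadNode := by
  induction n using Nat.strong_induction_on with
  | _ n ih =>
  intro θ hiso hbad hμn N hNn chain h0 hsucc
  by_contra hnot
  have hcon : ∀ i, (chain i).IsBadNode := fun i => by
    by_contra h
    exact hnot ⟨i, h⟩
  -- numerical floor: `μ ≥ 2`, hence `n ≥ 2` and the chain has at least four nodes
  have hμ2 : 2 ≤ θ.milnor := hF κ θ hiso hbad
  have hN3 : 3 ≤ N := by omega
  -- successor steps between arbitrary positions of the chain
  have hs : ∀ (i j : Fin (N + 1)), j.val = i.val + 1 → (chain i).IsSucc (chain j) := by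
    intro i j hij
    have hi : i.val < N := by have := j.isLt; omega
    have h := hsucc ⟨i.val, hi⟩
    have e1 : Fin.castSucc (⟨i.val, hi⟩ : Fin N) = i := Fin.ext rfl
    have e2 : Fin.succ (⟨i.val, hi⟩ : Fin N) = j := Fin.ext (by simp [hij])
    rw [e1, e2] at h
    exact h
  have e0 : (⟨0, by omega⟩ : Fin (N + 1)) = 0 := Fin.ext (by simp)
  have h0' : chain ⟨0, by omega⟩ = θ := by rw [e0]; exact h0
  -- every node of the chain is isolated
  have hisoAll : ∀ (j : ℕ) (hj : j < N + 1), (chain ⟨j, hj⟩).IsIsolated := by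
    intro j
    induction j with
    | zero => intro hj; rw [h0']; exact hiso
    | succ j ihj =>
      intro hj
      exact hI κ _ _ (ihj (by omega)) (hs ⟨j, by omega⟩ ⟨j + 1, hj⟩ rfl)
  -- restarting the induction at position `m` with a node of Milnor number `≤ n'`, `n' < n`
  have restart : ∀ (m : ℕ) (hm : m ≤ N) (n' : ℕ), n' < n → (chain ⟨m, by omega⟩).milnor ≤ n' →
      2 * n' ≤ N - m + 1 → False := by
    intro m hm n' hn' hμ' hN'
    obtain ⟨i, hi⟩ := ih n' hn' (chain ⟨m, by omega⟩) (hisoAll m (by omega)) (hcon _) hμ' (N - m) hN'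
      (fun i => chain ⟨i.val + m, by omega⟩) (by simp) (by
        intro i
        exact hs _ _ (by simp; omega))
    exact hi (hcon _)
  have hs01 : θ.IsSucc (chain ⟨1, by omega⟩) := by
    have h := hs ⟨0, by omega⟩ ⟨1, by omega⟩ rfl
    rwa [h0'] at h
  have hs12 : (chain ⟨1, by omega⟩).IsSucc (chain ⟨2, by omega⟩) := hs _ _ rfl
  have hs23 : (chain ⟨2, by omega⟩).IsSucc (chain ⟨3, by omega⟩) := hs _ _ rfl
  by_cases hL : θ.linearPart = 0
  · -- O-node: the Milnor number drops at the first successor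
    have hlt : (chain ⟨1, by omega⟩).milnor < θ.milnor :=
      hO κ θ _ hiso hbad hL hs01 (hisoAll 1 (by omega))
    exact restart 1 (by omega) (n - 1) (by omega) (by omega) (by omega)
  · rcases (show θ.milnor = 2 ∨ 3 ≤ θ.milnor by omega) with h2 | h3
    · -- N(2): the third successor is not bad
      exact hX κ θ _ _ _ hiso hbad hL h2 hs01 hs12 hs23 (hisoAll 1 (by omega)) (hcon _)
        (hisoAll 2 (by omega)) (hcon _) (hisoAll 3 (by omega)) (hcon _)
    · -- N(μ), μ ≥ 3: the Milnor number drops at the (bad) second successor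
      have hlt : (chain ⟨2, by omega⟩).milnor < θ.milnor :=
        hN κ θ _ _ hiso hbad hL h3 hs01 hs12 (hisoAll 1 (by omega)) (hcon _) (hisoAll 2 (by omega))
          (hcon _)
      exact restart 2 (by omega) (n - 1) (by omega) (by omega) (by omega)

/-- **`W1NPrint p` from the cascade** (every `p`; the characteristic hypothesis of `W1NPrint` is not used by
the induction — it is used inside the five supports only through D1's definitions, i.e. not at all: the
supports are characteristic-free statements whose PROOFS distinguish `p = 2`).  With `N := 2 μ(θ) − 1`.
[OURS · L1 W4.5c] — NOT a statement of the manuscript. -/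
theorem W1NPrint_of_cascade (hF : MilnorFloor) (hI : IsolatedSucc) (hO : OStep) (hN : NStep)
    (hX : NTwoExit) (p : ℕ) : W1NPrint p := by
  intro κ _ _ θ hiso hbad
  refine ⟨2 * θ.milnor - 1, fun chain h0 hsucc => ?_⟩
  exact exists_not_bad_of_milnor_le hF hI hO hN hX θ.milnor θ hiso hbad le_rfl _ (by omega) chain h0 hsucc

end W1NCascade

end Summit.ResolutionOfSingularities.ResolutionOfSingularities.Theorems.WildQuotientResolution.S1

end
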